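import Summits.QuantumFields.YangMills.Theorems.BalabanUVNodesN21HistoriesHybridLiftTower

/-!
# N21 (NE7c) — module 38f «THE CHARGE BY COUNTING»: 38c's (Eon) charge binder `hcharge : Σ_{ON → s′} q·B ≤ δr` from a COMPONENT COUNT bounded by a
# CUBE COUNT — lens Card 57 «`δr ≤ (1+q̄)^{ν̄} − 1`, K-uniform by `LiveWindow.count` alone» in the junction's own currency

Seat `pub-ymgap-dag-n21-e` (g12), own hand; lane `--kind proof --supports stmt-QuantumFields-20544 --as helper` (K3⁷ `SpineGivenEndpointR13SepCoPH`).
Count-neutral.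

WHAT IS PROVED ([textbook] finite combinatorics + 38c §0 `charge_le_of_components` BY NAME).  `card_le_card_of_disjoint_parts`: a family of pairwise
DISJOINT NON-EMPTY parts of a finite set `S` (the ℝ-able components of one level, each a union of that level's cubes) has at most `#S` members
(`Finset.card_le_card_biUnion`).  `charge_le_of_parts`: hence, if the ON senders into one receiver are labelled injectively by non-empty sub-families
of such a component family `U` (38c's `comp`), each sender's `q·B` at most the product of single-component bounds `qc i ∈ [0, q̄]`, their charge is
`≤ (1+q̄)^{#S} − 1`; `charge_le_of_liveWindow`: with `S` = the level-`j` window slots of cutoff `K` and `T4ShellMeasureLevels.LiveWindow.count`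
(`#S ≤ ν̄`), the exponent is any natural number `n ≥ ν̄`… stated with `n` and the hypothesis `#S ≤ n` (the record reads `n := ⌈ν̄⌉`; no real powers).
So 38c's `hcharge` holds with `δr := (1+q̄)^n − 1` as soon as (i) components are disjoint non-empty unions of window cubes, (ii) senders ↔ non-empty
component sub-families injectively (def-R's `Adm` bookkeeping), (iii) `q s · B s ≤ Π_{i ∈ comp s} qc i` with `qc ≤ q̄` — (iii) being NODE O's single-component
bound on the (1.88)-refined family (lens Cards 58∕63∕64; 38e), the ONE analytic input; (i)–(ii) geometry∕bookkeeping of the instance (t23 pen).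
§2 A SECOND A6 WITNESS for 38c's junction, WITH A SENT TERM (`liftedDensities_binders_inhabited_sent`): terms `Bool`, selector `fun _ => false` (`true`
sent to `false`), ON set `{true}`, unit densities∕inserts∕kernels, `q ≡ B ≡ 1`, charge `1 ≤ δr := 1` — the lift (`hybridLift_one_one`), the quotient bound,
the nesting, the charge and the denominator proviso are all ACTIVE (38c §4's witness has no sent term); consistency only, nothing about the record.

HONEST FRAMING.  [textbook] combinatorics + [folklore] bookkeeping; 0 def, 0 sorry; NOTHING of Bałaban's is asserted; `q̄` DISPLAYED, never estimated; NE7c ((M1) at the live slots) is NOT PRINTED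
and NOT PROVED; N21 NOT discharged; count-neutral; one finite 𝕋⁴ at fixed ε — nothing about ℝ⁴ ∕ OS ∕ mass gap ∕ Clay.

CITATION HEADER (lean-in-tree rule).  BY NAME: 38c `N21HistoriesHybridLiftTower.charge_le_of_components` (⟸ 38a §C `senderCharge_le_pow`, lens Card 57);
Mathlib `Finset.card_le_card_biUnion`, `Finset.biUnion_subset`; `T4ShellMeasureLevels.LiveWindow`; §2: 38c `shellWeightBound_histories_of_liftedDensities`,
38b `liftDensity_of_eq∕_of_ne` ∕ `hybridLift_empty` ∕ `preLaw` ∕ `postLaw`, 38a `hybridLift`.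
-/

set_option autoImplicit false

open scoped BigOperators ENNReal

namespace Summit.QuantumFields.YangMills.Theorems.N21ChargeByCounting

open Summit.QuantumFields.YangMills.Theorems.N21HistoriesHybridLiftTower (charge_le_of_components)

variable {α Cp ι : Type*} [DecidableEq α] [DecidableEq Cp]

omit [DecidableEq Cp] in
/-- **pairwise disjoint non-empty parts of a finite set are at most as many as its elements** (components of one level vs that level's cubes). [textbook] -/
theorem card_le_card_of_disjoint_parts (U : Finset Cp) (part : Cp → Finset α) (S : Finset α)
    (hsub : ∀ i ∈ U, part i ⊆ S) (hne : ∀ i ∈ U, (part i).Nonempty) (hdisj : (U : Set Cp).PairwiseDisjoint part) :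
    U.card ≤ S.card :=
  (Finset.card_le_card_biUnion hdisj hne).trans (Finset.card_le_card (Finset.biUnion_subset.2 hsub))

/-- **THE CHARGE FROM DISJOINT COMPONENTS INSIDE A CUBE SET**: ON senders labelled injectively by non-empty sub-families of a family `U` of pairwise
disjoint non-empty unions of cubes from `S`, with `q s ≤ Π_{i ∈ comp s} qc i`, `0 ≤ qc ≤ q̄`, have charge `≤ (1+q̄)^{#S} − 1` — in fact `≤ (1+q̄)^n − 1`
for any `n ≥ #S`. [textbook] -/
theorem charge_le_of_parts (A : Finset ι) (U : Finset Cp) (part : Cp → Finset α) (S : Finset α) (comp : ι → Finset Cp)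
    (hsub : ∀ i ∈ U, part i ⊆ S) (hne : ∀ i ∈ U, (part i).Nonempty) (hdisj : (U : Set Cp).PairwiseDisjoint part)
    (hinj : Set.InjOn comp A) (hcomp : ∀ s ∈ A, comp s ∈ U.powerset.erase ∅)
    {qr : ι → ℝ} {qc : Cp → ℝ} {qbar : ℝ} {n : ℕ} (hqr0 : ∀ s ∈ A, 0 ≤ qr s)
    (hqr : ∀ s ∈ A, qr s ≤ ∏ i ∈ comp s, qc i) (hqc0 : ∀ i ∈ U, 0 ≤ qc i) (hqc : ∀ i ∈ U, qc i ≤ qbar)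
    (hqbar : 0 ≤ qbar) (hn : S.card ≤ n) :
    ∑ s ∈ A, ENNReal.ofReal (qr s) ≤ ENNReal.ofReal ((1 + qbar) ^ n - 1) :=
  charge_le_of_components A U comp hinj hcomp hqr0 hqr hqc0 hqc ((card_le_card_of_disjoint_parts U part S hsub hne hdisj).trans hn) hqbar

open Literature.MathematicalPhysics.QuantumFieldTheory.Balaban1983to89.T4ShellMeasureLevels (LiveWindow)

/-- **… AT A LIVE LEVEL OF THE WINDOW** (lens Card 57 by `LiveWindow.count`): with `S` the level-`j` slots of cutoff `K` (`#S ≤ ν̄ ≤ n`), 38c's charge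
binder holds with `δr := (1+q̄)^n − 1`, K-UNIFORM BY COUNTING — the ONE remaining input being the single-component bound `qc ≤ q̄` (NODE O; on the
(1.88)-refined family, lens Cards 63∕64, 38e). [textbook] -/
theorem charge_le_of_liveWindow {σ : Type*} {C : ℕ → Finset σ} {lvl : ℕ → σ → ℕ} {N₁ : ℕ} {νbar : ℝ} (hwin : LiveWindow C lvl N₁ νbar)
    {n : ℕ} (hn : νbar ≤ n) (K j : ℕ) (A : Finset ι) (U : Finset Cp) (part : Cp → Finset σ) (comp : ι → Finset Cp)
    (hsub : ∀ i ∈ U, part i ⊆ (C K).filter (fun s => lvl K s = j)) (hne : ∀ i ∈ U, (part i).Nonempty)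
    (hdisj : (U : Set Cp).PairwiseDisjoint part) (hinj : Set.InjOn comp A) (hcomp : ∀ s ∈ A, comp s ∈ U.powerset.erase ∅)
    {qr : ι → ℝ} {qc : Cp → ℝ} {qbar : ℝ} (hqr0 : ∀ s ∈ A, 0 ≤ qr s)
    (hqr : ∀ s ∈ A, qr s ≤ ∏ i ∈ comp s, qc i) (hqc0 : ∀ i ∈ U, 0 ≤ qc i) (hqc : ∀ i ∈ U, qc i ≤ qbar) (hqbar : 0 ≤ qbar) :
    ∑ s ∈ A, ENNReal.ofReal (qr s) ≤ ENNReal.ofReal ((1 + qbar) ^ n - 1) := by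
  classical
  refine charge_le_of_parts A U part _ comp hsub hne hdisj hinj hcomp hqr0 hqr hqc0 hqc hqbar ?_
  exact_mod_cast (hwin.count K j).trans hn

/-! ## §2 THE BINDERS EXERCISED: a two-term toy with ONE SENT TERM, a non-empty ON set and charge `1` — a second A6 witness for 38c's junction
in which the lift, the quotient bound, the nesting and the charge are all ACTIVE (the §4 witness of 38c has no sent term) -/

section WitnessSent

open MeasureTheory Set Function
open Summit.QuantumFields.YangMills.Theorems.N21HybridResamplingLift (hybridLift)
open Summit.QuantumFields.YangMills.Theorems.N21HistoriesLiftedStageLaws (liftDensity liftDensity_of_eq liftDensity_of_ne preLaw postLaw hybridLift_empty)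
open Summit.QuantumFields.YangMills.Theorems.N21HistoriesHybridLiftTower (shellWeightBound_histories_of_liftedDensities)

/-- with no older coordinates and an empty fibre the lift of the unit density against the unit insert is the unit density. [folklore] -/
theorem hybridLift_one_one :
    hybridLift (fun _ : Unit => (Measure.dirac () : Measure Unit)) ∅ ∅ (fun _ => (1 : ℝ≥0∞)) (fun _ => (1 : ℝ≥0∞)) = fun _ => 1 := by
  rw [hybridLift_empty]; ext V
  simp only [lmarginal_empty, ENNReal.div_self one_ne_zero ENNReal.one_ne_top, mul_one]

/-- the two-term toy's post-ℝ stage laws (selector `fun _ => false`: `true` is SENT to `false`) are the product reference law. [folklore] -/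
theorem toy2_postLaw_eq (s : Bool) :
    postLaw (fun _ : Unit => (Measure.dirac () : Measure Unit)) ∅ (fun _ => ∅) (fun _ : Bool => false) (fun _ => (1 : ℝ≥0∞))
      (fun _ _ => (1 : ℝ≥0∞)) (fun _ _ => (1 : ℝ≥0∞)) s = Measure.pi fun _ : Unit => (Measure.dirac () : Measure Unit) := by
  have h : ∀ V, liftDensity (fun _ : Unit => (Measure.dirac () : Measure Unit)) ∅ (fun _ => ∅) (fun _ : Bool => false)
      (fun _ _ => (1 : ℝ≥0∞)) (fun _ _ => (1 : ℝ≥0∞)) s V = 1 := by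
    intro V
    cases s
    · exact congrFun (liftDensity_of_eq (μ := fun _ : Unit => (Measure.dirac () : Measure Unit)) (O := ∅) (F := fun _ => ∅)
        (sel := fun _ : Bool => false) (ins := fun _ _ => (1 : ℝ≥0∞)) (d := fun _ _ => (1 : ℝ≥0∞)) (s := false) rfl) V
    · rw [liftDensity_of_ne (sel := fun _ : Bool => false) (s := true) Bool.false_ne_true, hybridLift_one_one]
  simp only [postLaw, h, mul_one]
  exact withDensity_one

/-- the two-term toy's pre-ℝ stage laws are the product reference law. [folklore] -/
theorem toy2_preLaw_eq (s : Bool) :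
    preLaw (fun _ : Unit => (Measure.dirac () : Measure Unit)) (fun _ => (1 : ℝ≥0∞)) (fun _ _ => (1 : ℝ≥0∞)) s =
      Measure.pi fun _ : Unit => (Measure.dirac () : Measure Unit) := by
  simp only [preLaw, mul_one]; exact withDensity_one

/-- **SECOND A6 WITNESS — WITH A SENT TERM.**  38c's `shellWeightBound_histories_of_liftedDensities` APPLIED to: terms `Bool`, selector `fun _ => false`
(`true` SENT to the receiver `false`), ON set `{true}` at every stage and slot, unit densities ∕ inserts ∕ kernels on the one-point coordinate space,
quotient bound `q ≡ 1`, nesting `B ≡ 1`, CHARGE `Σ_{ON → false} q·B = 1 ≤ δr := 1`, `T K = I K k = univ`, one slot per cutoff, window box `κ ≡ ¼`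
(so the returned selection lies in `[¾, 1]` — a statement distinct from 38c §4's); every binder — now
including an ACTIVE lift (`hybridLift_one_one`), quotient, nesting, charge and denominator proviso — discharged in the kernel. [folklore] -/
theorem liftedDensities_binders_inhabited_sent :
    ∃ a : ℕ → ℕ → ℝ, ∀ K j, a K j ∈ Icc ((1 - (1 / 4 : ℝ)) * 1) 1 := by
  have hIcc_pos : ∀ {a : ℕ → ℝ}, (∀ j, a j ∈ Icc ((1 - (1 / 4 : ℝ)) * 1) 1) → ∀ j, 0 < a j := fun ha j => by
    have := (ha j).1; linarith
  have hμ1 : ∀ V : Unit → Unit, (∫⋯∫⁻_(∅ : Finset Unit), (fun _ : Unit → Unit => (1 : ℝ≥0∞)) ∂fun _ : Unit => (Measure.dirac () : Measure Unit)) V = 1 :=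
    fun V => by rw [lmarginal_empty]
  have hμ1' : ∀ V : Unit → Unit, (∫⋯∫⁻_((∅ : Finset Unit) ∪ ∅), (fun _ : Unit → Unit => (1 : ℝ≥0∞)) ∂fun _ : Unit => (Measure.dirac () : Measure Unit)) V = 1 :=
    fun V => by rw [Finset.empty_union, lmarginal_empty]
  have hcharge : ∀ s' : Bool, ∑ s ∈ (Finset.univ : Finset Bool).filter (fun s => s ∈ ({true} : Finset Bool) ∧ false = s'),
      (1 : ℝ≥0∞) * 1 ≤ ENNReal.ofReal 1 := by
    intro s'; cases s'
    · rw [show (Finset.univ : Finset Bool).filter (fun s => s ∈ ({true} : Finset Bool) ∧ false = false) = {true} from by decide]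
      simp
    · rw [show (Finset.univ : Finset Bool).filter (fun s => s ∈ ({true} : Finset Bool) ∧ false = true) = ∅ from by decide]
      simp
  have hP : ∀ s : Bool, ∑ e ∈ (Finset.univ : Finset Bool).filter (fun e => id e = s),
      preLaw (fun _ : Unit => (Measure.dirac () : Measure Unit)) (fun _ => (1 : ℝ≥0∞)) (fun _ _ => (1 : ℝ≥0∞)) e =
      postLaw (fun _ : Unit => (Measure.dirac () : Measure Unit)) ∅ (fun _ => ∅) (fun _ : Bool => false) (fun _ => (1 : ℝ≥0∞))
        (fun _ _ => (1 : ℝ≥0∞)) (fun _ _ => (1 : ℝ≥0∞)) s := by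
    intro s
    rw [show (Finset.univ : Finset Bool).filter (fun e => id e = s) = {s} from by ext e; simp, Finset.sum_singleton, toy2_preLaw_eq,
      toy2_postLaw_eq]
  obtain ⟨a, ha, -⟩ := shellWeightBound_histories_of_liftedDensities
    (𝔅 := fun _ => Unit) (X := fun _ _ => Unit) (μ := fun _ _ => Measure.dirac ()) (σ := Unit) (ι := Bool)
    (T := fun _ => Finset.univ) (C := fun _ => {()}) (small := fun _ _ => {()}) (smAll := fun _ _ => {()}) (nbhd := fun _ _ _ => {()})
    (lvl := fun K _ => K) (I := fun _ _ => Finset.univ) (pre := fun _ _ => id) (sel := fun _ _ _ => false) (On := fun _ _ _ => {true})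
    (O := fun _ _ => ∅) (Y := fun _ _ => ∅) (F := fun _ _ _ => ∅)
    (ΦA := fun _ _ _ _ => 1) (ΦB := fun _ _ _ _ => 1) (dA := fun _ _ _ _ _ => 1) (dB := fun _ _ _ _ _ => 1)
    (insA := fun _ _ _ _ _ => 1) (insB := fun _ _ _ _ _ => 1)
    (qA := fun _ _ _ _ => 1) (qB := fun _ _ _ _ => 1) (BA := fun _ _ _ _ => 1) (BB := fun _ _ _ _ => 1)
    (νA := fun _ _ _ _ => Measure.pi fun _ : Unit => (Measure.dirac () : Measure Unit))
    (νB := fun _ _ _ _ => Measure.pi fun _ : Unit => (Measure.dirac () : Measure Unit))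
    (uA := fun _ _ _ => 0) (uB := fun _ _ _ => 0) (θ := fun _ => 1) (κ := fun _ => 1 / 4) (ρ := fun _ => 0) (Δ := fun _ => 0)
    (l₀ := 0) (νbar := 1) (δr := 1) (B := 0) (N₁ := 0) (κmin := 1 / 4) (c₁ := 0) (ϑ := 1 / 2)
    (fun _ _ => measurable_const) (fun _ _ => measurable_const)
    (fun _ _ _ => Finset.Subset.rfl) (fun _ _ _ => Finset.Subset.rfl)
    (fun _ => one_pos) (fun _ => ⟨by norm_num, by norm_num⟩) (fun _ => ⟨le_rfl, one_pos⟩)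
    ⟨fun K _ _ => by omega, fun K _ _ => le_rfl, fun K j => by
      norm_num only [Nat.cast_le_one]
      exact (Finset.card_filter_le _ _).trans (by simp)⟩
    zero_le_one (fun _ => by simp) (fun _ _ _ _ _ => Finset.Subset.rfl)
    (fun _ _ _ _ _ _ _ => by simp) (fun _ _ _ _ _ _ _ => by simp)
    (fun K a ha _ _ _ _ => Filter.Eventually.of_forall fun _ _ _ => hIcc_pos ha K)
    (fun K a ha _ _ _ _ => Filter.Eventually.of_forall fun _ _ _ => hIcc_pos ha K)
    (fun _ _ _ _ _ => Finset.mem_univ _) (fun _ => rfl) (fun _ _ _ _ => Finset.mem_univ _) (fun _ _ _ _ => rfl)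
    (fun _ _ _ _ h => by rw [Finset.mem_singleton] at h; rw [h]; exact Bool.false_ne_true)
    (fun _ _ _ => disjoint_bot_left) (fun _ _ => disjoint_bot_left) (fun _ _ _ => disjoint_bot_left)
    -- run A
    (fun _ _ _ _ => measurable_const) (fun _ _ _ _ => measurable_const) (fun _ _ _ => measurable_const)
    (fun _ _ _ _ _ _ => rfl) (fun _ _ _ _ _ _ => rfl) (fun _ _ _ => lmarginal_empty _ _) (fun _ _ _ _ => by simp)
    (fun _ _ _ _ _ V => ⟨fun h => by rw [lmarginal_empty, hμ1] at h; exact (one_ne_zero h).elim, by rw [lmarginal_empty, hμ1]; exact ENNReal.one_ne_top⟩)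
    (fun _ _ _ _ _ _ _ _ _ _ => rfl) (fun _ _ _ _ _ _ _ _ _ => rfl) (fun _ _ _ _ _ => rfl) (fun _ _ _ _ _ _ _ => rfl)
    (fun _ _ _ _ _ _ _ _ V => by simp only [hμ1', one_mul, le_refl]) (fun _ _ _ _ _ _ _ _ _ => by simp only [one_mul, le_refl])
    (fun _ _ _ _ _ s' _ => hcharge s')
    (fun K a _ k _ s _ => hP s)
    (fun K a _ t _ τ _ => by
      rw [toy2_postLaw_eq, mul_zero, Real.exp_zero, ENNReal.ofReal_one, one_smul]; exact ⟨le_rfl, le_rfl⟩)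
    (fun _ _ _ _ _ => rfl)
    -- run B
    (fun _ _ _ _ => measurable_const) (fun _ _ _ _ => measurable_const) (fun _ _ _ => measurable_const)
    (fun _ _ _ _ _ _ => rfl) (fun _ _ _ _ _ _ => rfl) (fun _ _ _ => lmarginal_empty _ _) (fun _ _ _ _ => by simp)
    (fun _ _ _ _ _ V => ⟨fun h => by rw [lmarginal_empty, hμ1] at h; exact (one_ne_zero h).elim, by rw [lmarginal_empty, hμ1]; exact ENNReal.one_ne_top⟩)
    (fun _ _ _ _ _ _ _ _ _ _ => rfl) (fun _ _ _ _ _ _ _ _ _ => rfl) (fun _ _ _ _ _ => rfl) (fun _ _ _ _ _ _ _ => rfl)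
    (fun _ _ _ _ _ _ _ _ V => by simp only [hμ1', one_mul, le_refl]) (fun _ _ _ _ _ _ _ _ _ => by simp only [one_mul, le_refl])
    (fun _ _ _ _ _ s' _ => hcharge s')
    (fun K a _ k _ s _ => hP s)
    (fun K a _ t _ τ _ => by
      rw [toy2_postLaw_eq, mul_zero, Real.exp_zero, ENNReal.ofReal_one, one_smul]; exact ⟨le_rfl, le_rfl⟩)
    (fun _ _ _ _ _ => rfl)
    (by norm_num) (fun _ => le_rfl) (fun _ => by norm_num) (by norm_num) (by norm_num) (fun _ => by simp)
  exact ⟨a, ha⟩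

end WitnessSent

end Summit.QuantumFields.YangMills.Theorems.N21ChargeByCounting
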